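import Summits.ResolutionOfSingularities.ResolutionOfSingularities.Theorems.PurelyInseparableDim4ComponentThreads
import Literature.AlgebraicGeometry.Resolution.CentreBlowupOrdAlongBasics
import Mathlib.Data.Nat.Choose.Sum
import HarnessLib

/-!
# COMPONENT HOPPING AT `(q,q)` FOR EVERY `q ≥ 2`, part 1: the family `A_q`, `B_q` and its LONE COMPONENTS
# (cell `res-dim4-pi`, seat res-dim4-p-4 g2)

[OURS · counted 0 · a statement about OUR coordinate-centre frame; nothing here proves or refutes resolution of
singularities in dimension `≥ 4` / characteristic `p`.]

For `q ≥ 2`, over ANY field `K`: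
  `A_q = x₂·x₄^{2q−2} + x₁^{q−1}·x₂·(x₃ + 1)^{2q−2}`,   `B_q = x₂·x₃^{2q−2} + x₁^{q−1}·x₂·(x₄ + 1)^{2q−2}`
(`hopA`, `hopB`; states `sA`, `sB` with bookkeeping `r = 0`, `exc = {x₁}`).  This part: the binomial expansions,
supports and the two extreme coefficients (§1); `ord_{(x₁,x₂,x₄)} A_q = q`, every Hironaka-permissible coordinate
centre of `A_q` contains `x₁, x₂, x₄` (monomials `x₂x₄^{2q−2}` and `x₁^{q−1}x₂`), hence **the coordinate `q`-fold
locus of `A_q` has EXACTLY ONE component, the LINE `V(x₁,x₂,x₄)`** (`isComponent_sA_iff`), and symmetrically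
`V(x₁,x₂,x₃)` at `B_q` (§2).  Part 2 (`…ComponentHoppingAllPrimes`) proves the two hops `A_q ⇄ B_q` and the
rule-level negative for every `q ≥ 2`.
bears_on: LADDER-RESOLUTION:D157-DOOR2 (res-dim4-pi · R_OD-glob / component rules DEAD at every (q,q)).
Supports stmt-ResolutionOfSingularities-16155 (helper).
-/

set_option linter.dupNamespace false -- mandated namespace of this single-conjunct summit

noncomputable section

open MvPolynomial Finset
open scoped BigOperators

namespace Summit.ResolutionOfSingularities.ResolutionOfSingularities.Theorems.PIDim4

namespace HopAllPrimes

open ComponentThreads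
open Literature.AlgebraicGeometry.Resolution
open Literature.AlgebraicGeometry.Resolution.Hauser2010
open Literature.AlgebraicGeometry.Resolution.CentreBlowup

variable {K : Type} [Field K]

/-! ## §1 Exponents and the two polynomials -/

/-- the exponent of `x₁^a x₂^b x₃^c x₄^d`. [folklore] -/
def ex (a b c d : ℕ) : Fin 4 →₀ ℕ :=
  Finsupp.single 0 a + Finsupp.single 1 b + Finsupp.single 2 c + Finsupp.single 3 d

/-- `ex` coordinatewise. [folklore] -/
@[simp] theorem ex_apply (a b c d : ℕ) (i : Fin 4) : ex a b c d i = ![a, b, c, d] i := by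
  fin_cases i <;> simp [ex]

/-- total degree of `ex`. [folklore] -/
theorem degree_ex (a b c d : ℕ) : (ex a b c d).degree = a + b + c + d := by
  rw [Finsupp.degree_eq_sum, Fin.sum_univ_four]; simp

/-- `ex` as a product of powers. [folklore] -/
theorem monomial_ex (a b c d : ℕ) (co : K) :
    (monomial (ex a b c d) co : MvPolynomial (Fin 4) K) = C co * X 0 ^ a * X 1 ^ b * X 2 ^ c * X 3 ^ d := by
  rw [X_pow_eq_monomial, X_pow_eq_monomial, X_pow_eq_monomial, X_pow_eq_monomial, C_mul_monomial,
    monomial_mul, monomial_mul, monomial_mul, mul_one, mul_one, mul_one, mul_one]; rfl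

variable (K) in
/-- `A_q = x₂·x₄^{2q−2} + x₁^{q−1}·x₂·(x₃+1)^{2q−2}`. [OURS · the family] -/
def hopA (q : ℕ) : MvPolynomial (Fin 4) K :=
  X 1 * X 3 ^ (2 * q - 2) + X 0 ^ (q - 1) * X 1 * (X 2 + 1) ^ (2 * q - 2)

variable (K) in
/-- `B_q = x₂·x₃^{2q−2} + x₁^{q−1}·x₂·(x₄+1)^{2q−2}`, the `x₃ ↔ x₄` mirror of `A_q`. [OURS · the family] -/
def hopB (q : ℕ) : MvPolynomial (Fin 4) K :=
  X 1 * X 2 ^ (2 * q - 2) + X 0 ^ (q - 1) * X 1 * (X 3 + 1) ^ (2 * q - 2)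

/-- **binomial expansion of `A_q`.** [folklore] -/
theorem hopA_eq_sum (q : ℕ) : hopA K q = monomial (ex 0 1 0 (2 * q - 2)) 1 +
    ∑ m ∈ range (2 * q - 2 + 1), monomial (ex (q - 1) 1 m 0) (((2 * q - 2).choose m : ℕ) : K) := by
  rw [hopA, add_pow, Finset.mul_sum, monomial_ex]
  congr 1
  · rw [C_1]; ring
  · refine Finset.sum_congr rfl fun m _ => ?_
    rw [monomial_ex, map_natCast]; ring

/-- **binomial expansion of `B_q`.** [folklore] -/
theorem hopB_eq_sum (q : ℕ) : hopB K q = monomial (ex 0 1 (2 * q - 2) 0) 1 +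
    ∑ m ∈ range (2 * q - 2 + 1), monomial (ex (q - 1) 1 0 m) (((2 * q - 2).choose m : ℕ) : K) := by
  rw [hopB, add_pow, Finset.mul_sum, monomial_ex]
  congr 1
  · rw [C_1]; ring
  · refine Finset.sum_congr rfl fun m _ => ?_
    rw [monomial_ex, map_natCast]; ring

/-- every monomial of `A_q` is `x₂x₄^{2q−2}` or some `x₁^{q−1}x₂x₃^m`, `m ≤ 2q − 2`. [folklore] -/
theorem exists_of_mem_support_hopA {q : ℕ} {d : Fin 4 →₀ ℕ} (hd : d ∈ (hopA K q).support) :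
    d = ex 0 1 0 (2 * q - 2) ∨ ∃ m ≤ 2 * q - 2, d = ex (q - 1) 1 m 0 := by
  classical
  rw [hopA_eq_sum] at hd
  rcases Finset.mem_union.mp (MvPolynomial.support_add hd) with h | h
  · exact Or.inl (Finset.mem_singleton.mp (support_monomial_subset h))
  · obtain ⟨m, hm, -, h⟩ := PointBlowup.exists_of_mem_support_sum_monomial _ _ _ h
    exact Or.inr ⟨m, by have := Finset.mem_range.mp hm; omega, h.symm⟩

/-- every monomial of `B_q` is `x₂x₃^{2q−2}` or some `x₁^{q−1}x₂x₄^m`, `m ≤ 2q − 2`. [folklore] -/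
theorem exists_of_mem_support_hopB {q : ℕ} {d : Fin 4 →₀ ℕ} (hd : d ∈ (hopB K q).support) :
    d = ex 0 1 (2 * q - 2) 0 ∨ ∃ m ≤ 2 * q - 2, d = ex (q - 1) 1 0 m := by
  classical
  rw [hopB_eq_sum] at hd
  rcases Finset.mem_union.mp (MvPolynomial.support_add hd) with h | h
  · exact Or.inl (Finset.mem_singleton.mp (support_monomial_subset h))
  · obtain ⟨m, hm, -, h⟩ := PointBlowup.exists_of_mem_support_sum_monomial _ _ _ h
    exact Or.inr ⟨m, by have := Finset.mem_range.mp hm; omega, h.symm⟩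

/-- every monomial of `A_q` has `x₂`-exponent `1`. [folklore] -/
theorem apply_one_of_mem_support_hopA {q : ℕ} {d : Fin 4 →₀ ℕ} (hd : d ∈ (hopA K q).support) : d 1 = 1 := by
  rcases exists_of_mem_support_hopA hd with rfl | ⟨m, -, rfl⟩ <;> simp

/-- every monomial of `B_q` has `x₂`-exponent `1`. [folklore] -/
theorem apply_one_of_mem_support_hopB {q : ℕ} {d : Fin 4 →₀ ℕ} (hd : d ∈ (hopB K q).support) : d 1 = 1 := by
  rcases exists_of_mem_support_hopB hd with rfl | ⟨m, -, rfl⟩ <;> simp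

/-- every monomial of `A_q` has total degree `≥ q` (for `q ≥ 1`). [folklore] -/
theorem le_degree_of_mem_support_hopA {q : ℕ} (hq : 1 ≤ q) {d : Fin 4 →₀ ℕ} (hd : d ∈ (hopA K q).support) :
    q ≤ d.degree := by
  rcases exists_of_mem_support_hopA hd with rfl | ⟨m, -, rfl⟩ <;> rw [degree_ex] <;> omega

/-- every monomial of `B_q` has total degree `≥ q` (for `q ≥ 1`). [folklore] -/
theorem le_degree_of_mem_support_hopB {q : ℕ} (hq : 1 ≤ q) {d : Fin 4 →₀ ℕ} (hd : d ∈ (hopB K q).support) :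
    q ≤ d.degree := by
  rcases exists_of_mem_support_hopB hd with rfl | ⟨m, -, rfl⟩ <;> rw [degree_ex] <;> omega

/-- the coefficient of `x₂x₄^{2q−2}` in `A_q` is `1` (`q ≥ 2`). [folklore] -/
theorem coeff_hopA_first {q : ℕ} (hq : 2 ≤ q) : coeff (ex 0 1 0 (2 * q - 2)) (hopA K q) = 1 := by
  classical
  rw [hopA_eq_sum, coeff_add, coeff_monomial, if_pos rfl, coeff_sum, Finset.sum_eq_zero, add_zero]
  intro m _
  rw [coeff_monomial, if_neg]
  intro h; have := congrArg (· 3) h; simp at this; omega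

/-- the coefficient of `x₁^{q−1}x₂` in `A_q` is `1` (`q ≥ 2`). [folklore] -/
theorem coeff_hopA_second {q : ℕ} (hq : 2 ≤ q) : coeff (ex (q - 1) 1 0 0) (hopA K q) = 1 := by
  classical
  rw [hopA_eq_sum, coeff_add, coeff_monomial, if_neg, zero_add, coeff_sum, Finset.sum_eq_single 0]
  · rw [coeff_monomial, if_pos rfl]; simp
  · intro m _ hm; rw [coeff_monomial, if_neg]
    intro h; have := congrArg (· 2) h; simp at this; omega
  · intro h; exact absurd (Finset.mem_range.mpr (by omega)) h
  · intro h; have := congrArg (· 3) h; simp at this; omega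

/-- the coefficient of `x₂x₃^{2q−2}` in `B_q` is `1` (`q ≥ 2`). [folklore] -/
theorem coeff_hopB_first {q : ℕ} (hq : 2 ≤ q) : coeff (ex 0 1 (2 * q - 2) 0) (hopB K q) = 1 := by
  classical
  rw [hopB_eq_sum, coeff_add, coeff_monomial, if_pos rfl, coeff_sum, Finset.sum_eq_zero, add_zero]
  intro m _
  rw [coeff_monomial, if_neg]
  intro h; have := congrArg (· 2) h; simp at this; omega

/-- the coefficient of `x₁^{q−1}x₂` in `B_q` is `1` (`q ≥ 2`). [folklore] -/
theorem coeff_hopB_second {q : ℕ} (hq : 2 ≤ q) : coeff (ex (q - 1) 1 0 0) (hopB K q) = 1 := by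
  classical
  rw [hopB_eq_sum, coeff_add, coeff_monomial, if_neg, zero_add, coeff_sum, Finset.sum_eq_single 0]
  · rw [coeff_monomial, if_pos rfl]; simp
  · intro m _ hm; rw [coeff_monomial, if_neg]
    intro h; have := congrArg (· 3) h; simp at this; omega
  · intro h; exact absurd (Finset.mem_range.mpr (by omega)) h
  · intro h; have := congrArg (· 2) h; simp at this; omega

/-- `A_q ≠ 0`. [folklore] -/
theorem hopA_ne_zero {q : ℕ} (hq : 2 ≤ q) : hopA K q ≠ 0 := fun h => by
  have := coeff_hopA_first (K := K) hq; rw [h, coeff_zero] at this; exact zero_ne_one this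

/-- `B_q ≠ 0`. [folklore] -/
theorem hopB_ne_zero {q : ℕ} (hq : 2 ≤ q) : hopB K q ≠ 0 := fun h => by
  have := coeff_hopB_first (K := K) hq; rw [h, coeff_zero] at this; exact zero_ne_one this

/-! ## §2 The states, the line centres, the lone components -/

/-- the line centre `V(z, x₁, x₂, x₄)` at `A_q`. [folklore] -/
def SA : Finset (Fin 4) := {0, 1, 3}

/-- the line centre `V(z, x₁, x₂, x₃)` at `B_q`. [folklore] -/
def SB : Finset (Fin 4) := {0, 1, 2}

/-- `Σ_{SA} d = d₁ + d₂ + d₄`. [folklore] -/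
theorem degIn_SA (d : Fin 4 →₀ ℕ) : degIn SA d = d 0 + d 1 + d 3 :=
  degIn_triple (by decide) (by decide) (by decide) d

/-- `Σ_{SB} d = d₁ + d₂ + d₃`. [folklore] -/
theorem degIn_SB (d : Fin 4 →₀ ℕ) : degIn SB d = d 0 + d 1 + d 2 :=
  degIn_triple (by decide) (by decide) (by decide) d

variable (K) in
/-- the state `A_q` with bookkeeping `r = 0`, `exc = {x₁}`. [OURS · the family] -/
def sA (q : ℕ) : State K := ⟨hopA K q, 0, {0}⟩

variable (K) in
/-- the state `B_q` with bookkeeping `r = 0`, `exc = {x₁}`. [OURS · the family] -/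
def sB (q : ℕ) : State K := ⟨hopB K q, 0, {0}⟩

/-- `ord_{(x₁,x₂,x₄)} A_q = q` (`q ≥ 2`). [folklore] -/
theorem ordAlong_SA_hopA {q : ℕ} (hq : 2 ≤ q) : ordAlong SA (hopA K q) = (q : ℕ∞) := by
  apply le_antisymm
  · have := ordAlong_le_of_coeff_ne_zero (S := SA) (d := ex (q - 1) 1 0 0) (F := hopA K q)
      (by rw [coeff_hopA_second hq]; exact one_ne_zero)
    rw [degIn_SA] at this; simp at this
    exact le_trans this (by exact_mod_cast (by omega : q - 1 + 1 ≤ q))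
  · refine le_ordAlong_of_forall fun d hd => ?_
    rcases exists_of_mem_support_hopA hd with rfl | ⟨m, -, rfl⟩ <;> rw [degIn_SA] <;> simp <;> omega

/-- `ord_{(x₁,x₂,x₃)} B_q = q` (`q ≥ 2`). [folklore] -/
theorem ordAlong_SB_hopB {q : ℕ} (hq : 2 ≤ q) : ordAlong SB (hopB K q) = (q : ℕ∞) := by
  apply le_antisymm
  · have := ordAlong_le_of_coeff_ne_zero (S := SB) (d := ex (q - 1) 1 0 0) (F := hopB K q)
      (by rw [coeff_hopB_second hq]; exact one_ne_zero)
    rw [degIn_SB] at this; simp at this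
    exact le_trans this (by exact_mod_cast (by omega : q - 1 + 1 ≤ q))
  · refine le_ordAlong_of_forall fun d hd => ?_
    rcases exists_of_mem_support_hopB hd with rfl | ⟨m, -, rfl⟩ <;> rw [degIn_SB] <;> simp <;> omega

/-- **a permissible coordinate centre of `A_q` contains `x₁, x₂, x₄`** (`q ≥ 2`). [folklore] -/
theorem SA_subset_of_isPermissibleCentre {q : ℕ} (hq : 2 ≤ q) {S' : Finset (Fin 4)}
    (hS' : IsPermissibleCentre q S' (hopA K q)) : SA ⊆ S' := by
  classical
  have h1 : (q : ℕ∞) ≤ (degIn S' (ex 0 1 0 (2 * q - 2)) : ℕ∞) :=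
    le_trans hS'.2 (ordAlong_le_of_coeff_ne_zero (by rw [coeff_hopA_first hq]; exact one_ne_zero))
  have h2 : (q : ℕ∞) ≤ (degIn S' (ex (q - 1) 1 0 0) : ℕ∞) :=
    le_trans hS'.2 (ordAlong_le_of_coeff_ne_zero (by rw [coeff_hopA_second hq]; exact one_ne_zero))
  have h1' : q ≤ degIn S' (ex 0 1 0 (2 * q - 2)) := by exact_mod_cast h1
  have h2' : q ≤ degIn S' (ex (q - 1) 1 0 0) := by exact_mod_cast h2
  -- `x₄ ∈ S'`: otherwise `S' ⊆ {x₁,x₂,x₃}` and the first monomial has `S'`-degree `≤ 1`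
  have h3 : (3 : Fin 4) ∈ S' := by
    by_contra h3
    have hsub : S' ⊆ ({0, 1, 2} : Finset (Fin 4)) := fun i hi => by
      fin_cases i <;> simp_all
    have := le_trans h1' (degIn_mono hsub _)
    rw [degIn_triple (by decide) (by decide) (by decide)] at this; simp at this; omega
  -- `x₁ ∈ S'`: otherwise the second monomial has `S'`-degree `≤ 1`
  have h0 : (0 : Fin 4) ∈ S' := by
    by_contra h0
    have hsub : S' ⊆ ({1, 2, 3} : Finset (Fin 4)) := fun i hi => by
      fin_cases i <;> simp_all
    have := le_trans h2' (degIn_mono hsub _)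
    rw [degIn_triple (by decide) (by decide) (by decide)] at this; simp at this; omega
  -- `x₂ ∈ S'`: otherwise the second monomial has `S'`-degree `≤ q − 1`
  have h1m : (1 : Fin 4) ∈ S' := by
    by_contra h1m
    have hsub : S' ⊆ ({0, 2, 3} : Finset (Fin 4)) := fun i hi => by
      fin_cases i <;> simp_all
    have := le_trans h2' (degIn_mono hsub _)
    rw [degIn_triple (by decide) (by decide) (by decide)] at this; simp at this; omega
  intro i hi
  simp only [SA, Finset.mem_insert, Finset.mem_singleton] at hi
  rcases hi with rfl | rfl | rfl <;> assumption

/-- **a permissible coordinate centre of `B_q` contains `x₁, x₂, x₃`** (`q ≥ 2`). [folklore] -/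
theorem SB_subset_of_isPermissibleCentre {q : ℕ} (hq : 2 ≤ q) {S' : Finset (Fin 4)}
    (hS' : IsPermissibleCentre q S' (hopB K q)) : SB ⊆ S' := by
  classical
  have h1 : (q : ℕ∞) ≤ (degIn S' (ex 0 1 (2 * q - 2) 0) : ℕ∞) :=
    le_trans hS'.2 (ordAlong_le_of_coeff_ne_zero (by rw [coeff_hopB_first hq]; exact one_ne_zero))
  have h2 : (q : ℕ∞) ≤ (degIn S' (ex (q - 1) 1 0 0) : ℕ∞) :=
    le_trans hS'.2 (ordAlong_le_of_coeff_ne_zero (by rw [coeff_hopB_second hq]; exact one_ne_zero))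
  have h1' : q ≤ degIn S' (ex 0 1 (2 * q - 2) 0) := by exact_mod_cast h1
  have h2' : q ≤ degIn S' (ex (q - 1) 1 0 0) := by exact_mod_cast h2
  have h3 : (2 : Fin 4) ∈ S' := by
    by_contra h3
    have hsub : S' ⊆ ({0, 1, 3} : Finset (Fin 4)) := fun i hi => by
      fin_cases i <;> simp_all
    have := le_trans h1' (degIn_mono hsub _)
    rw [degIn_triple (by decide) (by decide) (by decide)] at this; simp at this; omega
  have h0 : (0 : Fin 4) ∈ S' := by
    by_contra h0
    have hsub : S' ⊆ ({1, 2, 3} : Finset (Fin 4)) := fun i hi => by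
      fin_cases i <;> simp_all
    have := le_trans h2' (degIn_mono hsub _)
    rw [degIn_triple (by decide) (by decide) (by decide)] at this; simp at this; omega
  have h1m : (1 : Fin 4) ∈ S' := by
    by_contra h1m
    have hsub : S' ⊆ ({0, 2, 3} : Finset (Fin 4)) := fun i hi => by
      fin_cases i <;> simp_all
    have := le_trans h2' (degIn_mono hsub _)
    rw [degIn_triple (by decide) (by decide) (by decide)] at this; simp at this; omega
  intro i hi
  simp only [SB, Finset.mem_insert, Finset.mem_singleton] at hi
  rcases hi with rfl | rfl | rfl <;> assumption

/-- **`V(x₁,x₂,x₄)` is a component of the coordinate `q`-fold locus of `A_q`** (`q ≥ 2`). [folklore] -/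
theorem isComponent_SA {q : ℕ} (hq : 2 ≤ q) : IsComponent q SA (hopA K q) := by
  refine ⟨⟨⟨0, by simp [SA]⟩, by rw [ordAlong_SA_hopA hq]⟩, fun k hk hle => ?_⟩
  have hne : (SA.erase k).Nonempty := by
    rw [← Finset.card_pos, Finset.card_erase_of_mem hk]; decide
  exact Finset.notMem_erase k SA (SA_subset_of_isPermissibleCentre hq ⟨hne, hle⟩ hk)

/-- **`V(x₁,x₂,x₃)` is a component of the coordinate `q`-fold locus of `B_q`** (`q ≥ 2`). [folklore] -/
theorem isComponent_SB {q : ℕ} (hq : 2 ≤ q) : IsComponent q SB (hopB K q) := by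
  refine ⟨⟨⟨0, by simp [SB]⟩, by rw [ordAlong_SB_hopB hq]⟩, fun k hk hle => ?_⟩
  have hne : (SB.erase k).Nonempty := by
    rw [← Finset.card_pos, Finset.card_erase_of_mem hk]; decide
  exact Finset.notMem_erase k SB (SB_subset_of_isPermissibleCentre hq ⟨hne, hle⟩ hk)

/-- **LONE COMPONENT at `A_q`**: `V(x_S)` is a component of the coordinate `q`-fold locus of `A_q` iff
`S = {x₁,x₂,x₄}` (`q ≥ 2`). [OURS] -/
theorem isComponent_sA_iff {q : ℕ} (hq : 2 ≤ q) (S' : Finset (Fin 4)) :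
    IsComponent q S' (sA K q).F ↔ S' = SA := by
  refine ⟨fun h => ?_, fun h => h ▸ isComponent_SA hq⟩
  have hsub : SA ⊆ S' := SA_subset_of_isPermissibleCentre hq h.1
  by_contra hne
  -- `S'` is strictly bigger, so it contains `x₃`, and `S' ∖ {x₃} ⊇ SA` is still permissible
  have h2 : (2 : Fin 4) ∈ S' := by
    by_contra h2
    apply hne
    refine Finset.Subset.antisymm (fun i hi => ?_) hsub
    have : i ≠ 2 := fun h => h2 (h ▸ hi)
    fin_cases i <;> simp_all [SA]
  have hperm : (q : ℕ∞) ≤ ordAlong (S'.erase 2) (hopA K q) :=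
    le_trans (by rw [ordAlong_SA_hopA hq]) (ordAlong_mono (fun i hi => by
      rw [Finset.mem_erase]
      exact ⟨by fin_cases i <;> simp_all [SA], hsub hi⟩) _)
  exact h.2 2 h2 hperm

/-- **LONE COMPONENT at `B_q`**: components of `B_q` are exactly `{x₁,x₂,x₃}` (`q ≥ 2`). [OURS] -/
theorem isComponent_sB_iff {q : ℕ} (hq : 2 ≤ q) (S' : Finset (Fin 4)) :
    IsComponent q S' (sB K q).F ↔ S' = SB := by
  refine ⟨fun h => ?_, fun h => h ▸ isComponent_SB hq⟩
  have hsub : SB ⊆ S' := SB_subset_of_isPermissibleCentre hq h.1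
  by_contra hne
  have h3 : (3 : Fin 4) ∈ S' := by
    by_contra h3
    apply hne
    refine Finset.Subset.antisymm (fun i hi => ?_) hsub
    have : i ≠ 3 := fun h => h3 (h ▸ hi)
    fin_cases i <;> simp_all [SB]
  have hperm : (q : ℕ∞) ≤ ordAlong (S'.erase 3) (hopB K q) :=
    le_trans (by rw [ordAlong_SB_hopB hq]) (ordAlong_mono (fun i hi => by
      rw [Finset.mem_erase]
      exact ⟨by fin_cases i <;> simp_all [SB], hsub hi⟩) _)
  exact h.2 3 h3 hperm

end HopAllPrimes

end Summit.ResolutionOfSingularities.ResolutionOfSingularities.Theorems.PIDim4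

end
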